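import Literature.Geometry.Symplectic.PALFFibreCollarLevels
import Literature.Geometry.Symplectic.PALFKasField
import Literature.Geometry.Symplectic.PALFKasCount
import Literature.Geometry.Symplectic.SteinSeamForms
import Literature.Topology.FourManifolds.BoundaryFieldGluing
import Literature.Topology.FourManifolds.BoundaryTangentLift
import HarnessLib

/-!
# Angle-preserving flow-out data near the vertical boundary of a Lefschetz fibration

Topic `Literature/Geometry/Symplectic` (fact seat
`provefact-Literature.Geometry.Symplectic.Oba2016_s-add47373d4`; a brick of the fibre-page statement
`hF` of `kasHandleCount_of_planarFibreMorse`: the planarity of the regular fibre is read off the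
planarity of the pages of the boundary open book by flowing the fibre over a ray into the page
over that ray).  For a PALF `f : W → 𝔻²` (`Literature.Geometry.Symplectic.PALF`), flow-out data `D`
(collar coordinate `σ`) and a unit vector `e ∈ ℝ²`:

* `angleForm_rot90`, `eq_inner_smul_of_angleForm_eq_zero` — elementary identities of the angle form `dφ_p(q) = p₀ q₁ - p₁ q₀`;
* `PALF.exists_angleForm_mfderiv_comp_incl_ne_zero` — **off the binding, the boundary map
  `f ∘ incl` moves the angle**: at `y ∈ ∂W` with `f y ≠ 0` some tangent vector `u` of `∂W` has
  `dφ_{f y}(d(f ∘ incl)_y u) ≠ 0` (the open book: `proj = f/‖f‖` has non-vanishing angular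
  differential off the binding, `OpenBook.angularDeriv_ne_zero`, `PALF.coe_proj_eq`);
* `PALF.exists_width_forall_exists_angleForm_ne_zero` — the same with the *fixed* covector
  `dφ_e`, uniformly on a thin closed sector `{⟪e, f⟫ ≥ ρ♭, |dφ_e(f)| ≤ w₀}` of the boundary
  (openness of the condition, compactness of `∂W`);
* `PALF.exists_flowoutInput_angleForm_eq_zero` — **angle-preserving flow-out data**: flow-out data
  `D″` with the same collar coordinate whose field satisfies `dφ_e(df(ξ″)) = 0` on the sector slab
  `{σ ≤ s₀, ⟪e, f⟫ ≥ ρ♭, |dφ_e(f)| ≤ w₀}` (a boundary-tangent correction of `D.ξ` by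
  `Literature.Topology.FourManifolds.exists_contMDiff_lift_tangent'`, renormalised to `dσ = 1`
  near `∂W` with `Literature.Geometry.Symplectic.exists_smooth_recip_floor`);
* `PALF.exists_lt_one_forall_inner_mfderiv_neg` — **near the vertical boundary every flow-out
  field decreases `‖f‖`**: `⟪f, df(ξ)⟫ < 0 wherever `‖f‖ ≥ ρ″`, for some `ρ″ < 1`
  (`PALF.inner_mfderiv_neg_of_norm_eq_one` and compactness).

Everything is proved; no definitions, no named facts.

## References

* A. Kas, *On the handlebody decomposition associated to a Lefschetz fibration*, Pacific J.
  Math. 89 (1980), §2. [Kas1980]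
* J. B. Etnyre, *Lectures on open book decompositions and contact structures*, Clay Math. Proc. 5
  (2006), §3. [Etnyre2006]
-/

open scoped Manifold ContDiff Topology RealInnerProductSpace
open Set Function Filter Metric

noncomputable section

namespace Literature.Geometry.Symplectic

open Literature.Topology.FourManifolds

universe u

/-! ### §1 The angle form -/

/-- `dφ_{a p} = a dφ_p` (private copy of the lemma of `GirouxContactPathTheta.lean`, to keep the
imports light). [folklore] -/
private theorem angleForm_smul_fst (a : ℝ) (p q : EuclideanSpace ℝ (Fin 2)) :
    angleForm (a • p) q = a * angleForm p q := by
  simp only [angleForm_apply, PiLp.smul_apply, smul_eq_mul]; ring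

/-- `dφ_p(p) = 0` (private copy, as above). [folklore] -/
private theorem angleForm_apply_self (p : EuclideanSpace ℝ (Fin 2)) : angleForm p p = 0 := by
  simp only [angleForm_apply]; ring

/-- `dφ_p(a q + r) = a dφ_p(q) + dφ_p(r)` (linearity, for rewriting). [folklore] -/
theorem angleForm_smul_add (p q r : EuclideanSpace ℝ (Fin 2)) (a : ℝ) :
    angleForm p (a • q + r) = a * angleForm p q + angleForm p r := by
  rw [map_add, map_smul, smul_eq_mul]

/-- The counterclockwise normal `J e = (-e₁, e₀)` of a unit vector has `dφ_e(J e) = 1`. [folklore] -/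
theorem angleForm_rot90 {e : EuclideanSpace ℝ (Fin 2)} (he : ‖e‖ = 1) :
    angleForm e (!₂[-e 1, e 0]) = 1 := by
  rw [EuclideanSpace.norm_eq, Real.sqrt_eq_one, Fin.sum_univ_two, Real.norm_eq_abs,
    Real.norm_eq_abs, sq_abs, sq_abs] at he
  simp [angleForm_apply]
  nlinarith [he]

/-- A vector with `dφ_e(q) = 0`, `e` a unit vector, is `⟪e, q⟫ e`. [folklore] -/
theorem eq_inner_smul_of_angleForm_eq_zero {e : EuclideanSpace ℝ (Fin 2)} (he : ‖e‖ = 1)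
    {q : EuclideanSpace ℝ (Fin 2)} (hq : angleForm e q = 0) : q = ⟪e, q⟫ • e := by
  rw [EuclideanSpace.norm_eq, Real.sqrt_eq_one, Fin.sum_univ_two, Real.norm_eq_abs,
    Real.norm_eq_abs, sq_abs, sq_abs] at he
  rw [angleForm_apply] at hq
  have hinner : ⟪e, q⟫ = e 0 * q 0 + e 1 * q 1 := by
    rw [EuclideanSpace.inner_eq_star_dotProduct]
    simp [dotProduct, Fin.sum_univ_two]; ring
  ext i
  fin_cases i
  · show q 0 = (⟪e, q⟫ • e) 0
    rw [PiLp.smul_apply, smul_eq_mul, hinner]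
    linear_combination (-(q 0)) * he + (-(e 1)) * hq
  · show q 1 = (⟪e, q⟫ • e) 1
    rw [PiLp.smul_apply, smul_eq_mul, hinner]
    linear_combination (-(q 1)) * he + (e 0) * hq

/-- `|⟪e, q⟫| ≤ ‖q‖` for a unit vector `e`. [folklore] -/
theorem abs_inner_le_norm_of_norm_eq_one {e : EuclideanSpace ℝ (Fin 2)} (he : ‖e‖ = 1)
    (q : EuclideanSpace ℝ (Fin 2)) : |⟪e, q⟫| ≤ ‖q‖ := by
  have h := abs_real_inner_le_norm e q
  rwa [he, one_mul] at h

/-- The derivative of the normalisation `q ↦ ‖q‖⁻¹ q` at `q ≠ 0` is `v ↦ ‖q‖⁻¹ v + ℓ(v) q` for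
some functional `ℓ`; in particular `dφ_q` of it is `‖q‖⁻¹ dφ_q(v)`. [folklore] -/
theorem exists_hasFDerivAt_normalize {q : EuclideanSpace ℝ (Fin 2)} (hq : q ≠ 0) :
    ∃ ℓ : EuclideanSpace ℝ (Fin 2) →L[ℝ] ℝ,
      HasFDerivAt (fun p : EuclideanSpace ℝ (Fin 2) => ‖p‖⁻¹ • p)
        (‖q‖⁻¹ • ContinuousLinearMap.id ℝ (EuclideanSpace ℝ (Fin 2)) + ℓ.smulRight q) q := by
  have h1 : DifferentiableAt ℝ (fun p : EuclideanSpace ℝ (Fin 2) => ‖p‖⁻¹) q :=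
    ((contDiffAt_norm ℝ hq (n := 1)).differentiableAt one_ne_zero).inv (norm_ne_zero_iff.2 hq)
  refine ⟨fderiv ℝ (fun p : EuclideanSpace ℝ (Fin 2) => ‖p‖⁻¹) q, ?_⟩
  exact h1.hasFDerivAt.smul (hasFDerivAt_id q)

variable {W : Type u} [TopologicalSpace W] [ChartedSpace (EuclideanHalfSpace 4) W]
  [IsManifold (𝓡∂ 4) ∞ W]
  {o : SmoothOrientation (𝓡∂ 4) W} {b : BoundaryData (𝓡∂ 4) W (𝓡 3)}

namespace PALF

/-! ### §2 Off the binding, the boundary map moves the angle -/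

/-- The boundary map `f ∘ incl : ∂W → ℝ²` is smooth. [folklore] -/
theorem contMDiff_comp_incl (P : PALF o b) :
    ContMDiff (𝓡 3) 𝓘(ℝ, EuclideanSpace ℝ (Fin 2)) ∞ (P.f ∘ b.incl) :=
  P.contMDiff.comp b.isSmoothEmbedding.contMDiff

/-- **Off the binding, the boundary map moves the angle** (the open-book axiom of a PALF): at a
point `y ∈ ∂W` with `f y ≠ 0` some tangent vector `u` of the boundary manifold has
`dφ_{f y}(d(f ∘ incl)_y u) ≠ 0`.  (`proj = f/‖f‖` near `y`, so `dθ_y = ‖f y‖⁻² dφ_{f y} ∘ d(f ∘ incl)_y`,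
and `dθ_y ≠ 0` off the binding.) [cite: Etnyre2006, §3 (Def. 2.8)] -/
theorem exists_angleForm_mfderiv_comp_incl_ne_zero (P : PALF o b) {y : b.carrier}
    (hy : P.f (b.incl y) ≠ 0) :
    ∃ u : EuclideanSpace ℝ (Fin 3),
      angleForm (P.f (b.incl y)) (mfderiv (𝓡 3) 𝓘(ℝ, EuclideanSpace ℝ (Fin 2)) (P.f ∘ b.incl) y u) ≠ 0 := by
  have hyB : y ∉ P.ob.binding := fun h => hy ((P.mem_binding_iff y).1 h)
  have hne : angularDeriv P.ob.proj y ≠ 0 := P.ob.angularDeriv_ne_zero y hyB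
  obtain ⟨u, hu⟩ : ∃ u, angularDeriv P.ob.proj y u ≠ 0 := by
    by_contra h
    push Not at h
    exact hne (ContinuousLinearMap.ext fun u => by rw [h u]; rfl)
  refine ⟨u, fun h0 => hu ?_⟩
  rw [angularDeriv_apply]
  -- `proj = N ∘ (f ∘ incl)` near `y`, `N q = ‖q‖⁻¹ q`
  set g : b.carrier → EuclideanSpace ℝ (Fin 2) := P.f ∘ b.incl with hg
  set q : EuclideanSpace ℝ (Fin 2) := P.f (b.incl y) with hq
  have hgs : ContMDiff (𝓡 3) 𝓘(ℝ, EuclideanSpace ℝ (Fin 2)) ∞ g := P.contMDiff_comp_incl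
  have hopen : IsOpen {z : b.carrier | g z ≠ 0} := isOpen_ne_fun hgs.continuous continuous_const
  have hev : (fun z => ((P.ob.proj z : Metric.sphere (0 : EuclideanSpace ℝ (Fin 2)) 1) :
      EuclideanSpace ℝ (Fin 2))) =ᶠ[𝓝 y] fun z => ‖g z‖⁻¹ • g z := by
    filter_upwards [hopen.mem_nhds (show g y ≠ 0 from hy)] with z hz
    exact P.coe_proj_eq z hz
  obtain ⟨ℓ, hN⟩ := exists_hasFDerivAt_normalize (show q ≠ 0 from hy)
  have hgd : HasMFDerivAt (𝓡 3) 𝓘(ℝ, EuclideanSpace ℝ (Fin 2)) g y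
      (mfderiv (𝓡 3) 𝓘(ℝ, EuclideanSpace ℝ (Fin 2)) g y) :=
    (hgs.mdifferentiableAt (by simp)).hasMFDerivAt
  have hcomp : HasMFDerivAt (𝓡 3) 𝓘(ℝ, EuclideanSpace ℝ (Fin 2))
      ((fun p : EuclideanSpace ℝ (Fin 2) => ‖p‖⁻¹ • p) ∘ g) y
      ((‖q‖⁻¹ • ContinuousLinearMap.id ℝ (EuclideanSpace ℝ (Fin 2)) + ℓ.smulRight q).comp
        (mfderiv (𝓡 3) 𝓘(ℝ, EuclideanSpace ℝ (Fin 2)) g y)) :=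
    HasMFDerivAt.comp y (g := fun p : EuclideanSpace ℝ (Fin 2) => ‖p‖⁻¹ • p) hN.hasMFDerivAt hgd
  have hD := (hcomp.congr_of_eventuallyEq hev).mfderiv
  rw [hD]
  have hproj : ((P.ob.proj y : Metric.sphere (0 : EuclideanSpace ℝ (Fin 2)) 1) :
      EuclideanSpace ℝ (Fin 2)) = ‖q‖⁻¹ • q := P.coe_proj_eq y hy
  rw [hproj]
  set v : EuclideanSpace ℝ (Fin 2) := mfderiv (𝓡 3) 𝓘(ℝ, EuclideanSpace ℝ (Fin 2)) g y u with hv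
  have h0' : angleForm q v = 0 := h0
  have e1 : ((‖q‖⁻¹ • ContinuousLinearMap.id ℝ (EuclideanSpace ℝ (Fin 2)) + ℓ.smulRight q) v) =
      ‖q‖⁻¹ • v + ℓ v • q := rfl
  show angleForm (‖q‖⁻¹ • q)
      ((‖q‖⁻¹ • ContinuousLinearMap.id ℝ (EuclideanSpace ℝ (Fin 2)) + ℓ.smulRight q) v) = 0
  rw [e1, angleForm_smul_fst, angleForm_smul_add, map_smul, angleForm_apply_self, smul_eq_mul,
    mul_zero, add_zero, h0', mul_zero, mul_zero]

/-! ### §3 A uniform sector on the boundary -/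

/-- The set of boundary points where some tangent vector moves the `e`-angle of `f` is open
(continuity of `dg` on a parallel local section). [folklore] -/
theorem isOpen_setOf_exists_angleForm_ne_zero (P : PALF o b) (e : EuclideanSpace ℝ (Fin 2)) :
    IsOpen {y : b.carrier | ∃ u : EuclideanSpace ℝ (Fin 3),
      angleForm e (mfderiv (𝓡 3) 𝓘(ℝ, EuclideanSpace ℝ (Fin 2)) (P.f ∘ b.incl) y u) ≠ 0} := by
  rw [isOpen_iff_mem_nhds]
  rintro y₀ ⟨u₀, hu₀⟩
  have hg : ContMDiff (𝓡 3) 𝓘(ℝ, EuclideanSpace ℝ (Fin 2)) ∞ (P.f ∘ b.incl) := P.contMDiff_comp_incl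
  set κ : b.carrier → ℝ := fun y => angleForm e (mfderiv (𝓡 3) 𝓘(ℝ, EuclideanSpace ℝ (Fin 2))
    (P.f ∘ b.incl) y (tangentCoordChange (𝓡 3) y₀ y y u₀)) with hκ
  have hκc : ContinuousOn κ (chartAt (EuclideanSpace ℝ (Fin 3)) y₀).source :=
    (angleForm e).continuous.comp_continuousOn
      (contMDiffOn_mfderiv_section hg (contMDiffOn_parallelSection y₀ u₀)).continuousOn
  have hmem : (chartAt (EuclideanSpace ℝ (Fin 3)) y₀).source ∈ 𝓝 y₀ :=
    (chartAt (EuclideanSpace ℝ (Fin 3)) y₀).open_source.mem_nhds (mem_chart_source _ y₀)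
  have h0 : κ y₀ ≠ 0 := by
    show angleForm e (mfderiv (𝓡 3) 𝓘(ℝ, EuclideanSpace ℝ (Fin 2)) (P.f ∘ b.incl) y₀
      (tangentCoordChange (𝓡 3) y₀ y₀ y₀ u₀)) ≠ 0
    rw [parallelSection_self]; exact hu₀
  have hne : ∀ᶠ y in 𝓝 y₀, κ y ≠ 0 := (hκc.continuousAt hmem).eventually_ne h0
  filter_upwards [hne] with y hy
  exact ⟨_, hy⟩

variable [T2Space W] [CompactSpace W]

omit [T2Space W] in
/-- **A uniform sector.**  For a unit vector `e` and `ρ♭ > 0` there is `w₀ > 0` such that at every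
boundary point of the closed sector `{⟪e, f⟫ ≥ ρ♭, |dφ_e(f)| ≤ w₀}` some tangent vector of the
boundary moves the `e`-angle of `f`.  (On the ray itself `dφ_e = ⟪e, f⟫⁻¹ dφ_f` and
`exists_angleForm_mfderiv_comp_incl_ne_zero` applies; the condition is open and `∂W` compact.)
[folklore] -/
theorem exists_width_forall_exists_angleForm_ne_zero (P : PALF o b) {e : EuclideanSpace ℝ (Fin 2)}
    (he : ‖e‖ = 1) {ρ : ℝ} (hρ : 0 < ρ) :
    ∃ w₀ : ℝ, 0 < w₀ ∧ ∀ y : b.carrier, ρ ≤ ⟪e, P.f (b.incl y)⟫ →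
      |angleForm e (P.f (b.incl y))| ≤ w₀ →
        ∃ u : EuclideanSpace ℝ (Fin 3),
          angleForm e (mfderiv (𝓡 3) 𝓘(ℝ, EuclideanSpace ℝ (Fin 2)) (P.f ∘ b.incl) y u) ≠ 0 := by
  haveI : CompactSpace b.carrier := b.compactSpace_carrier
  set O : Set b.carrier := {y | ∃ u : EuclideanSpace ℝ (Fin 3),
    angleForm e (mfderiv (𝓡 3) 𝓘(ℝ, EuclideanSpace ℝ (Fin 2)) (P.f ∘ b.incl) y u) ≠ 0} with hO
  have hOo : IsOpen O := P.isOpen_setOf_exists_angleForm_ne_zero e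
  have hfc : Continuous fun y : b.carrier => P.f (b.incl y) :=
    P.contMDiff.continuous.comp b.continuous_incl
  set K : Set b.carrier := {y | ρ ≤ ⟪e, P.f (b.incl y)⟫} ∩ Oᶜ with hK
  have hKc : IsCompact K :=
    ((isClosed_le continuous_const (continuous_const.inner hfc)).inter hOo.isClosed_compl).isCompact
  have habs : Continuous fun y : b.carrier => |angleForm e (P.f (b.incl y))| :=
    ((angleForm e).continuous.comp hfc).abs
  have hpos : ∀ y ∈ K, 0 < |angleForm e (P.f (b.incl y))| := by
    intro y hy
    rw [abs_pos]
    intro h0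
    apply hy.2
    have hq := eq_inner_smul_of_angleForm_eq_zero he h0
    have hfne : P.f (b.incl y) ≠ 0 := by
      intro h
      have h1 : ρ ≤ ⟪e, P.f (b.incl y)⟫ := hy.1
      rw [h, inner_zero_right] at h1
      linarith
    obtain ⟨u, hu⟩ := P.exists_angleForm_mfderiv_comp_incl_ne_zero hfne
    refine ⟨u, ?_⟩
    rw [hq, angleForm_smul_fst] at hu
    exact right_ne_zero_of_mul hu
  by_cases hne : K.Nonempty
  · obtain ⟨y₀, hy₀, hmin⟩ := hKc.exists_isMinOn hne habs.continuousOn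
    refine ⟨|angleForm e (P.f (b.incl y₀))| / 2, by linarith [hpos y₀ hy₀], fun y h1 h2 => ?_⟩
    by_contra hyO
    have hyK : y ∈ K := ⟨h1, hyO⟩
    have h3 := isMinOn_iff.1 hmin y hyK
    linarith [hpos y₀ hy₀]
  · refine ⟨1, one_pos, fun y h1 _ => ?_⟩
    by_contra hyO
    exact hne ⟨y, h1, hyO⟩

/-! ### §4 Angle-preserving flow-out data -/

/-- **Angle-preserving flow-out data** (Kas 1980, §2: near the vertical boundary the fibration is
the product of the boundary open book with the collar).  For flow-out data `D`, a unit vector `e`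
and `ρ♭ > 0` there are flow-out data `D″` with the same collar coordinate and `s₀, w₀ > 0` such that
`dφ_e(df(ξ″)) = 0` on the sector slab `{σ ≤ s₀, ⟪e, f⟫ ≥ ρ♭, |dφ_e(f)| ≤ w₀}`: the flow-out of `D″`
keeps `f` on the ray `ℝ₊ e` there.  Construction: a boundary-tangent field `X` with
`d(dφ_e ∘ f)(X) = -d(dφ_e ∘ f)(D.ξ)` on the slab
(`Literature.Topology.FourManifolds.exists_contMDiff_lift_tangent'`; interior points of the slab are regular, boundary
points by `exists_width_forall_exists_angleForm_ne_zero`), then `ξ″ = η(dσ(D.ξ + X)) (D.ξ + X)`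
with `η = 1/·` on `[1/2, ∞)` (`dσ(X) = 0` on `∂W`, so `dσ(D.ξ + X) ≥ 1/2` near `∂W`).
[cite: Kas1980, §2] -/
theorem exists_flowoutInput_angleForm_eq_zero (P : PALF o b) (D : FlowoutInput 3 W)
    {e : EuclideanSpace ℝ (Fin 2)} (he : ‖e‖ = 1) {ρ : ℝ} (hρ : 0 < ρ) :
    ∃ (D'' : FlowoutInput 3 W) (s₀ w₀ : ℝ), 0 < s₀ ∧ 0 < w₀ ∧ (∀ x, D''.f x = D.f x) ∧
      ∀ x, D.f x ≤ s₀ → ρ ≤ ⟪e, P.f x⟫ → |angleForm e (P.f x)| ≤ w₀ →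
        angleForm e (mfderiv (𝓡∂ 4) 𝓘(ℝ, EuclideanSpace ℝ (Fin 2)) P.f x (D''.ξ x)) = 0 := by
  -- the slab avoids the critical points
  obtain ⟨σm, hσm, hσmle⟩ := P.exists_pos_forall_le_flowout D
  set s₀ : ℝ := σm / 2 with hs₀
  have hs₀pos : 0 < s₀ := by rw [hs₀]; linarith
  have hreg : ∀ x, D.f x ≤ s₀ → x ∉ P.crit := fun x hx hxc => by
    have := hσmle x hxc; rw [hs₀] at hx; linarith
  obtain ⟨w₀, hw₀, hsec⟩ := P.exists_width_forall_exists_angleForm_ne_zero he hρ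
  -- the scalar function `g = dφ_e ∘ f` and the right-hand side `c = -dg(D.ξ)`
  set g : W → ℝ := fun x => angleForm e (P.f x) with hg
  have hgs : ContMDiff (𝓡∂ 4) 𝓘(ℝ, ℝ) ∞ g := (angleForm e).contDiff.comp_contMDiff P.contMDiff
  have hdg : ∀ (x : W) (v : TangentSpace (𝓡∂ 4) x), mfderiv (𝓡∂ 4) 𝓘(ℝ, ℝ) g x v =
      angleForm e (mfderiv (𝓡∂ 4) 𝓘(ℝ, EuclideanSpace ℝ (Fin 2)) P.f x v) := by
    intro x v
    have h : HasMFDerivAt (𝓡∂ 4) 𝓘(ℝ, ℝ) g x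
        ((angleForm e).comp (mfderiv (𝓡∂ 4) 𝓘(ℝ, EuclideanSpace ℝ (Fin 2)) P.f x)) :=
      (angleForm e).hasFDerivAt.hasMFDerivAt.comp x (P.contMDiff.mdifferentiableAt (by simp)).hasMFDerivAt
    rw [h.mfderiv]; rfl
  set c : W → ℝ := fun x => -mlineDeriv (𝓡∂ 4) g x (D.ξ x) with hc
  have hcs : ContMDiff (𝓡∂ 4) 𝓘(ℝ, ℝ) ∞ c := (contMDiff_mlineDeriv_section hgs D.ξ_smooth).neg
  -- the slab
  set C : Set W := {x | D.f x ≤ s₀ ∧ ρ ≤ ⟪e, P.f x⟫ ∧ |g x| ≤ w₀} with hC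
  have hCc : IsClosed C := by
    rw [hC, Set.setOf_and, Set.setOf_and]
    exact (isClosed_le D.f_smooth.continuous continuous_const).inter
      ((isClosed_le continuous_const (continuous_const.inner P.contMDiff.continuous)).inter
        (isClosed_le (hgs.continuous.abs) continuous_const))
  have hint : ∀ x ∈ C, (𝓡∂ 4).IsInteriorPoint x →
      Surjective (mfderiv (𝓡∂ 4) 𝓘(ℝ, ℝ) g x) ∨ ∃ U ∈ 𝓝 x, ∀ y ∈ U, c y = 0 := by
    intro x hx _
    left
    rintro (r : ℝ)
    obtain ⟨v, hv⟩ := P.submersion x (hreg x hx.1) (r • (!₂[-e 1, e 0] : EuclideanSpace ℝ (Fin 2)))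
    refine ⟨v, ?_⟩
    show mfderiv (𝓡∂ 4) 𝓘(ℝ, ℝ) g x v = r
    rw [hdg, hv, map_smul, angleForm_rot90 he, smul_eq_mul, mul_one]
  have hbdry : ∀ x ∈ C, x ∈ (𝓡∂ 4).boundary W → ∀ w : ℝ,
      ∃ v : EuclideanSpace ℝ (Fin 4), v 0 = 0 ∧ mfderiv (𝓡∂ 4) 𝓘(ℝ, ℝ) g x v = w := by
    intro x hx hxb w
    rw [← b.range_incl] at hxb
    obtain ⟨y, rfl⟩ := hxb
    obtain ⟨u, hu⟩ := hsec y hx.2.1 hx.2.2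
    set a : ℝ := angleForm e (mfderiv (𝓡 3) 𝓘(ℝ, EuclideanSpace ℝ (Fin 2)) (P.f ∘ b.incl) y u) with ha
    set v : EuclideanSpace ℝ (Fin 4) := mfderiv (𝓡 3) (𝓡∂ 4) b.incl y ((w / a) • u) with hv
    have hv0 : v 0 = 0 :=
      (mem_boundaryTangentSpace_iff v).1
        (mfderiv_apply_mem_boundaryTangentSpace b.incl (b.incl_mem_boundary y) _)
    have hcomp : ∀ u' : EuclideanSpace ℝ (Fin 3),
        mfderiv (𝓡 3) 𝓘(ℝ, EuclideanSpace ℝ (Fin 2)) (P.f ∘ b.incl) y u' =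
          mfderiv (𝓡∂ 4) 𝓘(ℝ, EuclideanSpace ℝ (Fin 2)) P.f (b.incl y)
            (mfderiv (𝓡 3) (𝓡∂ 4) b.incl y u') := by
      intro u'
      rw [mfderiv_comp y (P.contMDiff.mdifferentiableAt (by simp))
        ((b.isSmoothEmbedding.contMDiff y).mdifferentiableAt (by simp))]
      rfl
    have e3 : (mfderiv (𝓡 3) 𝓘(ℝ, EuclideanSpace ℝ (Fin 2)) (P.f ∘ b.incl) y ((w / a) • u) :
        EuclideanSpace ℝ (Fin 2)) =
        (w / a) • (mfderiv (𝓡 3) 𝓘(ℝ, EuclideanSpace ℝ (Fin 2)) (P.f ∘ b.incl) y u :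
          EuclideanSpace ℝ (Fin 2)) :=
      ContinuousLinearMap.map_smul _ _ _
    refine ⟨v, hv0, ?_⟩
    rw [hdg]
    show angleForm e (mfderiv (𝓡∂ 4) 𝓘(ℝ, EuclideanSpace ℝ (Fin 2)) P.f (b.incl y)
      (mfderiv (𝓡 3) (𝓡∂ 4) b.incl y ((w / a) • u))) = w
    rw [← hcomp, e3]
    have h6 := ContinuousLinearMap.map_smul (angleForm e) (w / a)
      (mfderiv (𝓡 3) 𝓘(ℝ, EuclideanSpace ℝ (Fin 2)) (P.f ∘ b.incl) y u : EuclideanSpace ℝ (Fin 2))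
    refine h6.trans ?_
    show (w / a) • a = w
    rw [smul_eq_mul]
    field_simp
  obtain ⟨X, hXs, hXtan, hXC⟩ := exists_contMDiff_lift_tangent' hgs hcs hCc hint hbdry
  -- the corrected field and its `σ`-derivative
  set ξ₁ : Π x : W, TangentSpace (𝓡∂ 4) x := fun x => D.ξ x + X x with hξ₁
  have hξ₁s : ContMDiff (𝓡∂ 4) (𝓡∂ 4).tangent ∞ (fun x => (⟨x, ξ₁ x⟩ : TangentBundle (𝓡∂ 4) W)) :=
    D.ξ_smooth.add_section hXs
  set φ : W → ℝ := fun x => mlineDeriv (𝓡∂ 4) D.f x (ξ₁ x) with hφ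
  have hφs : ContMDiff (𝓡∂ 4) 𝓘(ℝ, ℝ) ∞ φ := contMDiff_mlineDeriv_section D.f_smooth hξ₁s
  have hφadd : ∀ x, φ x = mlineDeriv (𝓡∂ 4) D.f x (D.ξ x) + mlineDeriv (𝓡∂ 4) D.f x (X x) := by
    intro x
    exact (mfderiv (𝓡∂ 4) 𝓘(ℝ, ℝ) D.f x).map_add (D.ξ x) (X x)
  -- on `∂W`: `dσ(X) = 0`, so `φ = 1`
  have hσX : ∀ z ∈ (𝓡∂ 4).boundary W, mlineDeriv (𝓡∂ 4) D.f z (X z) = 0 := by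
    intro z hz
    have hz' := hz
    rw [← b.range_incl] at hz'
    obtain ⟨y, rfl⟩ := hz'
    have hXmem : (X (b.incl y) : EuclideanSpace ℝ (Fin 4)) ∈ boundaryTangentSpace :=
      (mem_boundaryTangentSpace_iff _).2 (hXtan _ hz)
    obtain ⟨u, hu⟩ := exists_mfderiv_incl_eq b y hXmem
    have hconst : mfderiv (𝓡 3) 𝓘(ℝ, ℝ) (D.f ∘ b.incl) y = 0 := by
      have : D.f ∘ b.incl = fun _ => (0 : ℝ) := funext fun x => D.f_incl b x
      rw [this]
      exact mfderiv_const
    have hcomp : mfderiv (𝓡 3) 𝓘(ℝ, ℝ) (D.f ∘ b.incl) y =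
        (mfderiv (𝓡∂ 4) 𝓘(ℝ, ℝ) D.f (b.incl y)).comp (mfderiv (𝓡 3) (𝓡∂ 4) b.incl y) :=
      mfderiv_comp y (D.f_smooth.mdifferentiableAt (by simp))
        ((b.isSmoothEmbedding.contMDiff y).mdifferentiableAt (by simp))
    have h := DFunLike.congr_fun (hcomp.symm.trans hconst) u
    have h' : mfderiv (𝓡∂ 4) 𝓘(ℝ, ℝ) D.f (b.incl y) (mfderiv (𝓡 3) (𝓡∂ 4) b.incl y u) = 0 := h
    rw [hu] at h'
    exact h'
  have hφbd : ∀ z ∈ (𝓡∂ 4).boundary W, φ z = 1 := by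
    intro z hz
    rw [hφadd, hσX z hz, add_zero]
    exact D.mlineDeriv_f_ξ z (by rw [(D.f_eq_zero_iff z).2 hz]; exact D.δ_pos.le)
  -- `φ > 1/2` on `{σ ≤ δ''}`
  obtain ⟨δ'', hδ'', hδ''φ⟩ : ∃ δ'' : ℝ, 0 < δ'' ∧ ∀ x, D.f x ≤ δ'' → 1 / 2 < φ x := by
    set K : Set W := {x | φ x ≤ 1 / 2} with hK
    have hKc : IsCompact K := (isClosed_le hφs.continuous continuous_const).isCompact
    have hKpos : ∀ x ∈ K, 0 < D.f x := by
      intro x hx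
      rcases (D.f_nonneg x).lt_or_eq with h | h
      · exact h
      · exfalso
        have hxb : x ∈ (𝓡∂ 4).boundary W := (D.f_eq_zero_iff x).1 h.symm
        have h1 := hφbd x hxb
        have h2 : φ x ≤ 1 / 2 := hx
        linarith
    by_cases hne : K.Nonempty
    · obtain ⟨x₀, hx₀, hmin⟩ := hKc.exists_isMinOn hne D.f_smooth.continuous.continuousOn
      refine ⟨D.f x₀ / 2, by linarith [hKpos x₀ hx₀], fun x hx => ?_⟩
      by_contra h
      push Not at h
      have h3 := isMinOn_iff.1 hmin x h
      linarith [hKpos x₀ hx₀]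
    · refine ⟨1, one_pos, fun x _ => ?_⟩
      by_contra h
      push Not at h
      exact hne ⟨x, h⟩
  -- renormalise
  obtain ⟨η, hηs, hηeq⟩ := exists_smooth_recip_floor (m₀ := 1 / 2) (by norm_num)
  set ξ'' : Π x : W, TangentSpace (𝓡∂ 4) x := fun x => η (φ x) • ξ₁ x with hξ''
  have hξ''s : ContMDiff (𝓡∂ 4) (𝓡∂ 4).tangent ∞
      (fun x => (⟨x, ξ'' x⟩ : TangentBundle (𝓡∂ 4) W)) :=
    (hηs.comp_contMDiff hφs).smul_section hξ₁s
  have hσ'' : ∀ z, D.f z ≤ δ'' → mlineDeriv (𝓡∂ 4) D.f z (ξ'' z) = 1 := by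
    intro z hz
    have h1 : 1 / 2 < φ z := hδ''φ z hz
    have e1 : mlineDeriv (𝓡∂ 4) D.f z (ξ'' z) = η (φ z) * φ z :=
      (mfderiv (𝓡∂ 4) 𝓘(ℝ, ℝ) D.f z).map_smul (η (φ z)) (ξ₁ z)
    rw [e1, hηeq _ h1.le, inv_mul_cancel₀ (by linarith)]
  refine ⟨⟨D.f, ξ'', δ'', hδ'', D.f_smooth, D.f_nonneg, D.f_eq_zero_iff, hξ''s, hσ''⟩, s₀, w₀,
    hs₀pos, hw₀, fun x => rfl, fun x h1 h2 h3 => ?_⟩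
  have hxC : x ∈ C := ⟨h1, h2, h3⟩
  show angleForm e (mfderiv (𝓡∂ 4) 𝓘(ℝ, EuclideanSpace ℝ (Fin 2)) P.f x (η (φ x) • ξ₁ x)) = 0
  have e1 : angleForm e (mfderiv (𝓡∂ 4) 𝓘(ℝ, EuclideanSpace ℝ (Fin 2)) P.f x (η (φ x) • ξ₁ x)) =
      mlineDeriv (𝓡∂ 4) g x (η (φ x) • ξ₁ x) := (hdg x _).symm
  have e2 : mlineDeriv (𝓡∂ 4) g x (η (φ x) • ξ₁ x) =
      η (φ x) * (mlineDeriv (𝓡∂ 4) g x (D.ξ x) + mlineDeriv (𝓡∂ 4) g x (X x)) := by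
    have h4 := (mfderiv (𝓡∂ 4) 𝓘(ℝ, ℝ) g x).map_smul (η (φ x)) (ξ₁ x)
    have h5 := (mfderiv (𝓡∂ 4) 𝓘(ℝ, ℝ) g x).map_add (D.ξ x) (X x)
    rw [h5] at h4
    exact h4
  have e3 : mlineDeriv (𝓡∂ 4) g x (X x) = c x := hXC x hxC
  rw [e1, e2, e3]
  show η (φ x) * (mlineDeriv (𝓡∂ 4) g x (D.ξ x) + -mlineDeriv (𝓡∂ 4) g x (D.ξ x)) = 0
  ring

/-! ### §5 Near the vertical boundary every flow-out field decreases `‖f‖` -/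

omit [T2Space W] in
/-- **Flow-out fields point radially inward near the vertical boundary**: for flow-out data `D`
there is `ρ″ < 1` with `⟪f x, df_x(ξ x)⟫ < 0` whenever `‖f x‖ ≥ ρ″` — at the vertical boundary
`{‖f‖ = 1}` because `ξ` is strictly inward there (`PALF.inner_mfderiv_neg_of_norm_eq_one`), and
nearby by compactness. [cite: Kas1980, §2] -/
theorem exists_lt_one_forall_inner_mfderiv_neg (P : PALF o b) (D : FlowoutInput 3 W) :
    ∃ ρ'' : ℝ, ρ'' < 1 ∧ ∀ x, ρ'' ≤ ‖P.f x‖ →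
      ⟪P.f x, mfderiv (𝓡∂ 4) 𝓘(ℝ, EuclideanSpace ℝ (Fin 2)) P.f x (D.ξ x)⟫ < 0 := by
  set φ : W → ℝ := fun x =>
    ⟪P.f x, mfderiv (𝓡∂ 4) 𝓘(ℝ, EuclideanSpace ℝ (Fin 2)) P.f x (D.ξ x)⟫ with hφ
  have hdc : Continuous fun x => mfderiv (𝓡∂ 4) 𝓘(ℝ, EuclideanSpace ℝ (Fin 2)) P.f x (D.ξ x) :=
    ((contMDiff_mfderiv_tangentBundle P.contMDiff).comp D.ξ_smooth).continuous
  have hφc : Continuous φ := P.contMDiff.continuous.inner hdc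
  have hV : ∀ x, ‖P.f x‖ = 1 → φ x < 0 := by
    intro x hx
    have h := P.inner_mfderiv_neg_of_norm_eq_one hx
      (halfSpaceCoord_flowout_ξ_pos D (P.mem_boundary_of_norm_eq_one hx))
    simpa using h
  set K : Set W := {x | 0 ≤ φ x} with hK
  have hKc : IsCompact K := (isClosed_le continuous_const hφc).isCompact
  have hKlt : ∀ x ∈ K, ‖P.f x‖ < 1 := by
    intro x hx
    rcases (P.norm_apply_le_one x).lt_or_eq with h | h
    · exact h
    · exfalso
      have h1 := hV x h
      have h2 : 0 ≤ φ x := hx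
      linarith
  by_cases hne : K.Nonempty
  · obtain ⟨x₀, hx₀, hmax⟩ := hKc.exists_isMaxOn hne (continuous_norm.comp P.contMDiff.continuous).continuousOn
    refine ⟨(‖P.f x₀‖ + 1) / 2, by linarith [hKlt x₀ hx₀], fun x hx => ?_⟩
    by_contra h
    push Not at h
    have h3 := isMaxOn_iff.1 hmax x h
    have h4 := hKlt x₀ hx₀
    have h5 : ‖P.f x‖ ≤ ‖P.f x₀‖ := h3
    linarith
  · refine ⟨0, one_pos, fun x _ => ?_⟩
    by_contra h
    push Not at h
    exact hne ⟨x, h⟩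

end PALF

end Literature.Geometry.Symplectic

end
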